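import Summits.BirchSwinnertonDyer.BirchSwinnertonDyer.Theorems.ResidualThetaTransportAtTwoResidualSignedLambdaLowerCMAtTwoCofreeSelmerTransfer
import Summits.BirchSwinnertonDyer.BirchSwinnertonDyer.Theorems.ResidualThetaTransportAtTwoResidualSignedLambdaLowerCMAtTwoCofreeAdmissible
import Summits.BirchSwinnertonDyer.BirchSwinnertonDyer.Theorems.ResidualThetaTransportAtTwoThetaTransportResidualUnramified
import Literature.NumberTheory.EllipticCurves.GreenbergVatsal2000.UnramifiedOutsideFinite
import Literature.NumberTheory.EllipticCurves.ZpExtensionUnramifiedProofs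
import HarnessLib

/-!
# A level class whose transfer is a relaxed Selmer class is ADMISSIBLE: `τ_{n,K} b ∈ unramifiedOutside Γ_∞ A_ρ p S₀` ⟹
# `b` dies on `Γ_n ⊓ I_𝔓` for every `𝔓 ∣ v`, `v ∉ S₀ ∪ {v ∣ p}` — the hypothesis `hψ₂` of the levelwise reciprocity core read off (EH)'s test class

Route `ResidualThetaTransportAtTwo` (RTT), crux RSL_g `ResidualSignedLambdaLowerCMAtTwo` (stmt-BirchSwinnertonDyer-22608), line «onepair»
(skeleton v3b), split stub EH `stub_reciprocity`; seat `prover-bsd-wall-tp2-p2x-w3` g17 (`--supports`, closes nothing). THEOREMS ONLY (no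
definition, no named fact, no instance, no `sorry`). BSD is not proved by any of this; RSL_g (22608) and K3 (20308) stay OPEN.

WHY. (EH) tests `x ∈ 𝐇¹_Γ(T_ρ)` against `s ∈ selRelSubgroup ⊆ unramifiedOutside Γ_∞ A_ρ 2 S₀`; written as a transfer `s = τ_{n,K} b`
(`…ReciprocityExhaustion`), the levelwise core `ThetaTransport.sum_localInvariantMap_cupProduct_shapiroLift_cofreeTorsion_eq_zero` (p688154) needs
`b` to die on `Γ_n ⊓ I_𝔓` for all `𝔓` over the places off `T ⊇ S₀ ∪ {v ∣ p}` — in `A_ρ[p^K]`-coefficients. This is the CONVERSE of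
`CofreeSelmerTransfer.transferH1_mem_unramifiedOutside` (T1 [unr]) and holds because, off `S₀ ∪ {p}`, inertia acts trivially on `A_ρ`
(`ρ` unramified) and lies inside `Γ_∞` (`ℤ_p`-extensions are unramified outside `p`):
* `smul_cofree_eq_of_mem_inertia'` — `ρ` unramified at `v` ⟹ `inertia v` fixes `A_ρ` (any rank `d`, any coefficient set `S`; twin of the
  `Set.range ι`/rank-2 lemma `ThetaTransport.smul_cofree_eq_of_mem_inertia`).
* **`resOfLe_transfer_mem_unramifiedOutside`** — `τ b ∈ unramifiedOutside Γ_∞ A_ρ ⟹ res_{Γ_∞} b ∈ unramifiedOutside Γ_∞ A_ρ[p^K]`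
  (`i_*` REFLECTS the unramified clause for the injective inclusion, `ThetaTransport.mem_unramifiedOutside_iff_pushH1_mem`).
* **`admissible_of_transfer_mem_unramifiedOutside`** — hence `resLe … (Γ_n ⊓ I_𝔓 ≤ Γ_n) 1 b = 0` for all `𝔓 ∣ v`, `v ∉ S'`, whenever
  `S' ⊇ S₀ ∪ {v ∣ p}` (all-primes form `GreenbergVatsal2000.resOfLe_inertia_inf_eq_zero_of_mem_unramifiedOutside` on `Γ_∞`, lifted to `Γ_n`
  along `I_𝔓 ≤ Γ_∞` = `ZpExtension.inertia_le_kerSubgroup_holds`, and the dialect bridge `ThetaTransport.resLe_inf_eq_zero_iff_resOfLe_inf_eq_zero`).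

References: [GreenbergVatsal2000] §2 pp. 16–17, 23; [Kato2004Asterisque] §8.2 (p. 181); [Washington1997] Prop. 13.2; [SerreGaloisCohomology1997] I §5.1.
-/

set_option autoImplicit false
-- the Theorems namespace of this sub repeats the summit name by design (D-0017 nested layout)
set_option linter.dupNamespace false

noncomputable section

open scoped Classical NumberField

namespace Summit.BirchSwinnertonDyer.BirchSwinnertonDyer.Theorems.ThetaTransport.Reciprocity

open CategoryTheory Field NumberField IsDedekindDomain
  Literature.NumberTheory.EllipticCurves Literature.NumberTheory.GaloisRepresentations
  Literature.NumberTheory.EllipticCurves.GreenbergSelmer Literature.NumberTheory.EllipticCurves.GreenbergVatsal2000 ZpExtension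
  Summit.BirchSwinnertonDyer.BirchSwinnertonDyer.Theorems

variable {p : ℕ} [Fact p.Prime] (S : Set (PadicAlgCl p)) {d : ℕ} (ρ : FramedGaloisRep ℚ ↥(padicCoeffIntegers S) d)
  (κ : ZpExtension ℚ p)

/-- **Inertia at an unramified place fixes `A_ρ`** (any rank, any coefficient set): `σ ∈ GreenbergSelmer.inertia v` (the inertia group of the
completion prime `adicCompletionPrime ℚ v`) acts trivially on `Cofree ρ F` when `ρ.IsUnramifiedAt v`. [cite: SilvermanAEC2009, Prop. VII.4.1(a)] -/
theorem smul_cofree_eq_of_mem_inertia' {v : HeightOneSpectrum (𝓞 ℚ)} (hρv : FramedGaloisRep.IsUnramifiedAt v ρ)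
    {σ : absoluteGaloisGroup ℚ} (hσ : σ ∈ inertia v) (a : Cofree ρ ↥(padicCoeffField S)) : σ • a = a := by
  obtain ⟨τ, hτ, rfl⟩ := hσ
  have hτ' : absGaloisRestrict ℚ (v.adicCompletion ℚ) τ ∈ (adicCompletionPrime ℚ v).inertia (absoluteGaloisGroup ℚ) := by
    rw [inertia_adicCompletionPrime_eq_map_absInertia]
    exact Subgroup.mem_map_of_mem _ hτ
  have h1 : ρ (absGaloisRestrict ℚ (v.adicCompletion ℚ) τ) = 1 := hρv _ (adicCompletionPrime_mem_primesAbove ℚ v) _ hτ'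
  obtain ⟨x, rfl⟩ := cofreeMk_surjective _ ρ a
  change absGaloisRestrict ℚ (v.adicCompletion ℚ) τ • cofreeMk _ ρ x = cofreeMk _ ρ x
  rw [smul_cofreeMk, fracRepresentation_apply_apply, h1, Units.val_one, Matrix.map_one _ (map_zero _) (map_one _), Matrix.one_mulVec]

variable (N : ℤ) (n : ℕ) {S₀ : Set (HeightOneSpectrum (𝓞 ℚ))}

/-- **The unramified clause reflects along the transfer**: if `τ_{n,N} b ∈ unramifiedOutside Γ_∞ A_ρ p S₀` and `ρ` is unramified at every
`v ∉ S₀` with `v ∤ p`, then `res_{Γ_∞ ≤ Γ_n} b ∈ unramifiedOutside Γ_∞ A_ρ[N] p S₀` (`(A_ρ[N] ↪ A_ρ)_*` is injective on cocycle values and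
inertia off `S₀ ∪ {p}` fixes `A_ρ`). [cite: GreenbergVatsal2000, §2 pp. 16–17, 23] -/
theorem resOfLe_transfer_mem_unramifiedOutside
    (hρ : ∀ v : HeightOneSpectrum (𝓞 ℚ), v ∉ S₀ → ((p : ℕ) : 𝓞 ℚ) ∉ v.asIdeal → FramedGaloisRep.IsUnramifiedAt v ρ)
    {b : subgroupH1 (κ.layerSubgroup n) ↥(AddSubgroup.torsionBy (Cofree ρ ↥(padicCoeffField S)) N)}
    (hb : resOfLe (Cofree ρ ↥(padicCoeffField S)) (κ.kerSubgroup_le_layerSubgroup n)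
      (pushH1 (κ.layerSubgroup n) (AddSubgroup.torsionBy (Cofree ρ ↥(padicCoeffField S)) N).subtype
        (CofreeSelmerTransfer.torsionBy_subtype_smul S ρ N) b) ∈ unramifiedOutside κ.kerSubgroup (Cofree ρ ↥(padicCoeffField S)) p S₀) :
    resOfLe ↥(AddSubgroup.torsionBy (Cofree ρ ↥(padicCoeffField S)) N) (κ.kerSubgroup_le_layerSubgroup n) b ∈
      unramifiedOutside κ.kerSubgroup ↥(AddSubgroup.torsionBy (Cofree ρ ↥(padicCoeffField S)) N) p S₀ := by
  rw [ThetaTransport.mem_unramifiedOutside_iff_pushH1_mem (AddSubgroup.torsionBy (Cofree ρ ↥(padicCoeffField S)) N).subtype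
    (CofreeSelmerTransfer.torsionBy_subtype_smul S ρ N) p S₀ (AddSubgroup.subtype_injective _)
    (fun v hv hvp y m ↦ smul_cofree_eq_of_mem_inertia' S ρ (hρ v hv hvp) ((mem_inertiaIn_iff _ v _).1 y.2).2 m)]
  rwa [ThetaTransport.resOfLe_pushH1] at hb

/-- **A level class whose transfer is unramified outside `S₀` is ADMISSIBLE off `S' ⊇ S₀ ∪ {v ∣ p}`**: `resLe … (Γ_n ⊓ I_𝔓 ≤ Γ_n) 1 b = 0`
for every `𝔓 ∣ v`, `v ∉ S'` — the hypothesis `hψ₂` of `ThetaTransport.sum_localInvariantMap_cupProduct_shapiroLift_cofreeTorsion_eq_zero` for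
the level class of a relaxed Selmer class. [cite: GreenbergVatsal2000, §2 pp. 16, 23] [cite: Kato2004Asterisque, §8.2 (p. 181)] [cite: Washington1997, Prop. 13.2] -/
theorem admissible_of_transfer_mem_unramifiedOutside
    (hρ : ∀ v : HeightOneSpectrum (𝓞 ℚ), v ∉ S₀ → ((p : ℕ) : 𝓞 ℚ) ∉ v.asIdeal → FramedGaloisRep.IsUnramifiedAt v ρ)
    {S' : Set (HeightOneSpectrum (𝓞 ℚ))} (hS₀ : S₀ ⊆ S') (hS : ∀ v : HeightOneSpectrum (𝓞 ℚ), ((p : ℕ) : 𝓞 ℚ) ∈ v.asIdeal → v ∈ S')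
    {b : H1 (cofreeTorsionGaloisModule S ρ N) (κ.layerSubgroup n)}
    (hb : resOfLe (Cofree ρ ↥(padicCoeffField S)) (κ.kerSubgroup_le_layerSubgroup n)
      (pushH1 (κ.layerSubgroup n) (AddSubgroup.torsionBy (Cofree ρ ↥(padicCoeffField S)) N).subtype
        (CofreeSelmerTransfer.torsionBy_subtype_smul S ρ N) b) ∈ unramifiedOutside κ.kerSubgroup (Cofree ρ ↥(padicCoeffField S)) p S₀) :
    ∀ v ∉ S', ∀ 𝔓 ∈ v.primesAbove,
      resLe (cofreeTorsionGaloisModule S ρ N).toTopRep (inf_le_left : κ.layerSubgroup n ⊓ 𝔓.inertia (absoluteGaloisGroup ℚ) ≤ κ.layerSubgroup n)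
        1 b = 0 := by
  intro v hv 𝔓 h𝔓
  have hvS₀ : v ∉ S₀ := fun h ↦ hv (hS₀ h)
  have hvp : ((p : ℕ) : 𝓞 ℚ) ∉ v.asIdeal := fun h ↦ hv (hS v h)
  -- on `Γ_∞`, all primes: `res_{I_𝔓 ⊓ Γ_∞} (res_{Γ_∞} b) = 0`
  have h1 := GreenbergVatsal2000.resOfLe_inertia_inf_eq_zero_of_mem_unramifiedOutside
    (resOfLe_transfer_mem_unramifiedOutside S ρ κ N n hρ hb) hvS₀ hvp h𝔓
  -- `I_𝔓 ≤ Γ_∞ ≤ Γ_n`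
  have hI : 𝔓.inertia (absoluteGaloisGroup ℚ) ≤ κ.kerSubgroup := ZpExtension.inertia_le_kerSubgroup_holds ℚ p κ hvp h𝔓
  have hle : 𝔓.inertia (absoluteGaloisGroup ℚ) ⊓ κ.layerSubgroup n ≤ 𝔓.inertia (absoluteGaloisGroup ℚ) ⊓ κ.kerSubgroup :=
    le_inf inf_le_left (inf_le_left.trans hI)
  rw [ThetaTransport.resLe_inf_eq_zero_iff_resOfLe_inf_eq_zero]
  have e1 := congrArg (fun f ↦ f b) (resOfLe_comp_holds (M := ↥(AddSubgroup.torsionBy (Cofree ρ ↥(padicCoeffField S)) N))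
    (hle.trans inf_le_right) (κ.kerSubgroup_le_layerSubgroup n))
  have e2 := congrArg (fun f ↦ f (resOfLe ↥(AddSubgroup.torsionBy (Cofree ρ ↥(padicCoeffField S)) N) (κ.kerSubgroup_le_layerSubgroup n) b))
    (resOfLe_comp_holds (M := ↥(AddSubgroup.torsionBy (Cofree ρ ↥(padicCoeffField S)) N)) hle
      (inf_le_right : 𝔓.inertia (absoluteGaloisGroup ℚ) ⊓ κ.kerSubgroup ≤ κ.kerSubgroup))
  simp only [AddMonoidHom.coe_comp, Function.comp_apply] at e1 e2
  change resOfLe ↥(AddSubgroup.torsionBy (Cofree ρ ↥(padicCoeffField S)) N)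
    ((hle.trans inf_le_right).trans (κ.kerSubgroup_le_layerSubgroup n)) b = 0
  rw [← e1, ← e2, h1, map_zero]

end Summit.BirchSwinnertonDyer.BirchSwinnertonDyer.Theorems.ThetaTransport.Reciprocity

end
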